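import Summits.ResolutionOfSingularities.ResolutionOfSingularities.Theorems.RadicialJungCleanModelsNSRankOneReductionOfCJS
import Summits.ResolutionOfSingularities.ResolutionOfSingularities.Theorems.RadicialJungCleanModelsDimOfLocalMonomialization
import HarnessLib

/-!
# `CleanModels` in dimension `4` ⟸ F-02 ∧ F-32 ∧ (LU with monomialisation at RANK-ONE valuations, trdeg 4) ∧ class (B)₄ ∧ patching₄ — ONE kernel node

Route `RadicialJung`, crux `CleanModels` (stmt-ResolutionOfSingularities-15917), registered skeleton `Cruxes/CleanModels/Lines/Sketch.lean`
rev 35 (sha16 de44649d8f729c3b), stub 7 `stub_cleanModelsDimGEFour`.  Explicit-unit seat `decomp-res-hand-2` g6 (structural hand).  OURS; structural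
bookkeeping, counted 0; nothing here proves resolution of singularities in characteristic `p`.

`cleanModels_dimFour_of_rankOne_cjs2020` — the `d = 4` slice of stub 7 (`CleanModels` for `dim W = 4`, the conclusion of
✓ `cleanModels_dim_of_localMonomialization 3`) from: the two PRINTED facts F-02 (`CossartPiltant2019`) and F-32 (`CossartJannsenSaito2020Embedded`),
the honest open local input `hMonoRankOne` = local uniformization WITH MONOMIALISATION of finitely generated models of function fields of
transcendence degree `≤ 4` along RANK-ONE valuations (the NS 2012 reduction ✓ `localMonomialization_four_of_rankOne_of_cjs2020` supplies all other
valuations), the class-(B) input `hND` and the Zariski–Piltant patching input `hZ` of ✓ `cleanModels_dim_of_localMonomialization` (both verbatim,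
`n = 3`).  Census node for the planner: in dimension `4` the crux is «ELU/LU₄ at rank one ∧ class (B)₄ ∧ patching₄» modulo print.
[cite: NovacoskiSpivakovsky2014, Thm. 1.2] [cite: CossartPiltant2019, Thm. 1.1] [cite: CossartJannsenSaito2020, Thm. 1.4] [cite: Piltant2013, Cor. 5.7]
-/

noncomputable section

set_option linter.dupNamespace false -- mandated namespace of this single-conjunct summit

open IsLocalRing AlgebraicGeometry CategoryTheory
open Literature.AlgebraicGeometry.Resolution Literature.AlgebraicGeometry.Motives

namespace Summit.ResolutionOfSingularities.ResolutionOfSingularities.Theorems.RadicialJung.CleanModels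

/-- **`CleanModels` in dimension `4` from F-02, F-32, rank-one LU-with-monomialisation, class (B)₄ and patching₄.**  See the module docstring.
[cite: NovacoskiSpivakovsky2014, Thm. 1.2] [cite: CossartPiltant2019, Thm. 1.1] [cite: CossartJannsenSaito2020, Thm. 1.4] [cite: Piltant2013, Cor. 5.7] -/
theorem cleanModels_dimFour_of_rankOne_cjs2020 (hCP : CossartPiltant2019.{0}) (hCJS : CossartJannsenSaito2020Embedded.{0})
    (hMonoRankOne : ∀ (k : Type) [Field k] (K : Type) [Field K] [Algebra k K] (O : ValuationSubring K),
      ¬ (∃ O₁ : ValuationSubring K, O ≤ O₁ ∧ O₁ ≠ O ∧ O₁ ≠ ⊤) →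
      ∀ (A : Subalgebra k K), A.toSubring ≤ O.toSubring → A.FG → IsFractionRing A K →
      ringKrullDim A ≤ (4 : WithBot ℕ∞) →
      ∀ Z : Finset K, (∀ z ∈ Z, z ∈ A) →
      ∃ (A' : Subalgebra k K), A'.toSubring ≤ O.toSubring ∧ A ≤ A' ∧ A'.FG ∧
      ∃ (_ : IsRegularLocalRing (locAtCentre A'.toSubring O)) (e : ℕ) (a : Fin e → ↥(locAtCentre A'.toSubring O)),
        Ideal.span (Set.range a) = IsLocalRing.maximalIdeal ↥(locAtCentre A'.toSubring O) ∧
        ringKrullDim ↥(locAtCentre A'.toSubring O) = (e : WithBot ℕ∞) ∧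
        ∀ z ∈ Z, z ≠ 0 → ∃ (v : ↥(locAtCentre A'.toSubring O)) (μ : Fin e → ℕ), IsUnit v ∧
          z = (v : K) * ∏ i, ((a i : ↥(locAtCentre A'.toSubring O)) : K) ^ (μ i))
    (hND : ∀ (p : ℕ), p.Prime →
    ∀ (k : Type) [Field k] [CharP k p] (K : Type) [Field K] [Algebra k K]
    (O : ValuationSubring K) (A : Subalgebra k K), A.toSubring ≤ O.toSubring → A.FG → IsFractionRing A K →
    ringKrullDim A ≤ ((3 + 1 : ℕ) : WithBot ℕ∞) → IsRegularLocalRing (locAtCentre A.toSubring O) →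
    ringKrullDim (locAtCentre A.toSubring O) = ((3 + 1 : ℕ) : WithBot ℕ∞) →
    (∀ (T : Subring K) (hT : T ≤ O.toSubring), A.toSubring ≤ T → (subringCentre T O hT).IsMaximal) →
    ∀ g₀ : K, (∀ c : K, c ^ p ≠ g₀) →
    (∀ f₀ : K, ∃ f₁ : K, O.valuation (g₀ - f₁ ^ p) < O.valuation (g₀ - f₀ ^ p)) →
    (∀ hk : ∀ c : k, algebraMap k K c ∈ O, transcendenceDefect k O hk ≠ 0) →
    ¬ (∃ π : K, π ≠ 0 ∧ (∀ x : K, O.valuation x < 1 → O.valuation x ≤ O.valuation π) ∧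
      (∀ x : K, x ≠ 0 → ∃ n : ℕ, O.valuation π ^ n ≤ O.valuation x)) →
    ∃ (A' : Subalgebra k K), A'.toSubring ≤ O.toSubring ∧ A ≤ A' ∧ A'.FG ∧
    ∃ (_ : IsRegularLocalRing (locAtCentre A'.toSubring O)) (c : Fin p → K), (∃ j : Fin p, (j : ℕ) ≠ 0 ∧ c j ≠ 0) ∧
    ((∃ (d m : ℕ) (hmd : m ≤ d) (t : Fin d → ↥(locAtCentre A'.toSubring O)) (a : Fin m → ℕ) (u : ↥(locAtCentre A'.toSubring O)), IsUnit u ∧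
    Ideal.span (Set.range t) = IsLocalRing.maximalIdeal ↥(locAtCentre A'.toSubring O) ∧
    ringKrullDim ↥(locAtCentre A'.toSubring O) = (d : WithBot ℕ∞) ∧ 0 < m ∧ (∀ i, ¬ p ∣ a i) ∧
    (∑ j : Fin p, c j ^ p * g₀ ^ (j : ℕ)) = (u : K) * ∏ i : Fin m, ((t (Fin.castLE hmd i) : ↥(locAtCentre A'.toSubring O)) : K) ^ (a i)) ∨
    (∃ u : ↥(locAtCentre A'.toSubring O), IsUnit u ∧ (∑ j : Fin p, c j ^ p * g₀ ^ (j : ℕ)) = (u : K) ∧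
    ∀ c' : ↥(locAtCentre A'.toSubring O), u - c' ^ p ∉ IsLocalRing.maximalIdeal ↥(locAtCentre A'.toSubring O)) ∨
    (∃ s c' : ↥(locAtCentre A'.toSubring O), (∑ j : Fin p, c j ^ p * g₀ ^ (j : ℕ)) = (s : K) ∧
    s - c' ^ p ∈ IsLocalRing.maximalIdeal ↥(locAtCentre A'.toSubring O) ∧
    s - c' ^ p ∉ IsLocalRing.maximalIdeal ↥(locAtCentre A'.toSubring O) ^ 2)))
    (hZ : ∀ (p : ℕ), p.Prime → ∀ (k K : Type) [Field k] [CharP k p] [Field K] [Algebra k K] [Algebra.EssFiniteType k K],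
    Algebra.trdeg k K = (3 + 1 : ℕ) → ∀ (g₀ : K) (M₁ M₂ : ProjModel k K) (U₁ : M₁.X.Opens) (U₂ : M₂.X.Opens),
    (∀ x ∈ U₁, ModelCleanRegAt p g₀ M₁ x) → (∀ x ∈ U₂, ModelCleanRegAt p g₀ M₂ x) →
    ∃ (N : ProjModel k K) (φ₁ : N.Hom M₁) (φ₂ : N.Hom M₂),
    (∀ y : N.X, φ₁.f y ∈ U₁ → ModelCleanRegAt p g₀ N y) ∧ (∀ y : N.X, φ₂.f y ∈ U₂ → ModelCleanRegAt p g₀ N y)) :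
    ∀ p : ℕ, p.Prime → ∀ (k : Type) [Field k] [CharP k p] (W : AlgebraicGeometry.Scheme.{0}) [AlgebraicGeometry.IsIntegral W] (f : W ⟶ AlgebraicGeometry.Spec (.of k)) (L : Type) [Field L] [Algebra W.functionField L], AlgebraicGeometry.IsSeparated f → AlgebraicGeometry.LocallyOfFiniteType f → AlgebraicGeometry.QuasiCompact f → Literature.AlgebraicGeometry.Resolution.Scheme.IsRegular W → IsPurelyInseparable W.functionField L → Module.finrank W.functionField L = p → topologicalKrullDim W = ((3 + 1 : ℕ) : WithBot ℕ∞) → ∃ (V : AlgebraicGeometry.Scheme.{0}) (π : V ⟶ W) (_ : AlgebraicGeometry.IsIntegral V) (_ : AlgebraicGeometry.IsDominant π), AlgebraicGeometry.IsProper π ∧ Literature.AlgebraicGeometry.Resolution.IsBirational π ∧ Literature.AlgebraicGeometry.Resolution.Scheme.IsRegular V ∧ (∀ v : V, (∃ (y : L) (g : W.functionField), y ∉ Set.range (algebraMap W.functionField L) ∧ algebraMap W.functionField L g = y ^ p ∧ ((∃ (d m : ℕ) (hmd : m ≤ d) (t : Fin d → V.presheaf.stalk v) (a : Fin m → ℕ),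 Ideal.span (Set.range t) = IsLocalRing.maximalIdeal (V.presheaf.stalk v) ∧ ringKrullDim (V.presheaf.stalk v) = (d : WithBot ℕ∞) ∧ 0 < m ∧ (∀ i, ¬ p ∣ a i) ∧ Literature.AlgebraicGeometry.Motives.RatFn.functionFieldMap π g = ∏ i : Fin m, (algebraMap (V.presheaf.stalk v) V.functionField (t (Fin.castLE hmd i))) ^ (a i)) ∨ (∃ u₀ : V.presheaf.stalk v, IsUnit u₀ ∧ Literature.AlgebraicGeometry.Motives.RatFn.functionFieldMap π g = algebraMap (V.presheaf.stalk v) V.functionField u₀ ∧ ((∀ c : V.presheaf.stalk v, u₀ - c ^ p ∉ IsLocalRing.maximalIdeal (V.presheaf.stalk v)) ∨ (∃ c : V.presheaf.stalk v, u₀ - c ^ p ∈ IsLocalRing.maximalIdeal (V.presheaf.stalk v) ∧ u₀ - c ^ p ∉ IsLocalRing.maximalIdeal (V.presheaf.stalk v) ^ 2)))))) := by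
  refine cleanModels_dim_of_localMonomialization 3 ?_ hND hZ
  intro k _ K _ _ O A hAO hAfg hfrac hdimA _ _ _ Z hZ'
  have hdimA' : ringKrullDim A ≤ (4 : WithBot ℕ∞) := hdimA
  exact localMonomialization_four_of_rankOne_of_cjs2020 hCP hCJS O (hMonoRankOne k K O) A hAO hAfg hfrac hdimA' Z hZ'

end Summit.ResolutionOfSingularities.ResolutionOfSingularities.Theorems.RadicialJung.CleanModels

end
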